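import Literature.NumberTheory.Rogawski1990.ArchLimitFormulaNoncompactWallConstTransport   -- ★ p842004 (b1): transport along `(0 2)` + equality of pinned constants
import Mathlib.Data.Fintype.Perm
import Mathlib.Data.Fintype.Pi
import HarnessLib

/-!
# (R1-h-d)(D2-coef) The noncompact (J-nc) constants of ONE place are ONE constant: the within-place coherence closure
(Rogawski (1990) §8.2 pp. 119, 122–124; Varadarajan (1989) §6.4 Thm 22; Bröcker–tom Dieck IV (3.2))

Topic `NumberTheory/Rogawski1990`; namespace `Literature.NumberTheory.Rogawski1990`.  THEOREMS ONLY (no definition, no instance, no notation, no named fact, no `sorry`).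
Cell `hodgecm-mathlib`, crux H413 (`stmt-HodgeConjecture-24833`); (R1-h-d) plan of F0P3a-p07 (g8), step (D2-coef) «the noncompact constants of one place are one `C_v`»
(p07 (g8) «CUT» 07:25:32Z); F0P3-p03 (g9).  Count-neutral floor-1 plumbing; HC_CM is proved only modulo the printed citations until rung 0 closes.

WHAT IS PROVED.
* §1 PURE COMBINATORICS of the four noncompact relabellings at a `(2,1)`-place (signs `x_i = re σ_w(α_i) ≠ 0`; `τ` is NONCOMPACT iff `x_{τ0}·x_{τ2} < 0`): the two primitive
  links — the wall-preserving swap `τ ↦ τ·(0 2)` (always) and the slot exchange `τ ↦ τ·(0 1)` (when `x_{τ0}·x_{τ1} > 0`) — CONNECT all noncompact `τ`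
  (`nc_closure_bool`, `decide` over the 8 sign patterns × 36 pairs), hence any family `c : Perm (Fin 3) → M` invariant under the two links is constant on the noncompact
  `τ` (**`const_eq_of_wallLinks`**).  The consumer discharges the `(0 2)`-link by ★ (b1) p842004 `archLimitFormulaNoncompactWall_const_eq_of_transport_swap02` (or §2 below) and
  the `(0 1)`-link by ★ (b2′) p842051 `archLimitFormulaNoncompactWall_const_eq_of_transport_of_torusFixing` at `T := D` (★ `formCongr_rescale01_map_diagonal`), each under its
  explicit transport hypotheses on `(ντ, νH)`.
* §2 ★ (b1) with a FREE target reference point `z₁t` (`hz : z₁∘(0 2)⁻¹ = z₁t`; at a wall point `z₁∘(0 2)⁻¹ = z₁` propositionally, not syntactically — `comp_swap02_symm_eq_self_of_wall`),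
  so that (D0-1)'s telescope (the SAME reference `z₁` on every `G_w(α∘τ)`) is served: `…_clause_transport_swap02_of_eq`, `…_const_eq_of_transport_swap02_of_eq`.

## References
* [Rogawski1990] J. D. Rogawski, *Automorphic Representations of Unitary Groups in Three Variables*, Ann. of Math. Stud. 123 (1990), §8.2 pp. 119, 122–124.
* [Varadarajan1989] V. S. Varadarajan, *An Introduction to Harmonic Analysis on Semisimple Lie Groups* (1989), §6.4 Thm 22.
* [BrockerTomDieck1985] T. Bröcker, T. tom Dieck, *Representations of Compact Lie Groups* (1985), IV (3.2).
-/

set_option autoImplicit false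

noncomputable section

open MeasureTheory Measure Filter Topology NumberField NumberField.InfinitePlace Matrix Equiv
open Literature.MeasureTheory.Group Literature.NumberTheory.Automorphic Literature.NumberTheory.Automorphic.UnitaryGroup
open Literature.LinearAlgebra.Matrix
open scoped Matrix MatrixGroups Matrix.Norms.Operator

namespace Literature.NumberTheory.Rogawski1990

/-! ## §1 The two primitive links connect all noncompact relabellings -/

section Combinatorics

set_option synthInstance.maxSize 4096 in
/-- **THE LINK GRAPH IS CONNECTED ON THE NONCOMPACT RELABELLINGS** (Boolean sign patterns; `decide`): for signs `s : Fin 3 → Bool` and `τ, τ′` with `s(τ0) ≠ s(τ2)`, `s(τ′0) ≠ s(τ′2)`,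
`τ′` is reached from `τ` by at most three of the moves `·(0 2)` (always allowed) and `·(0 1)` (allowed when the slots `0, 1` carry equal signs).
[cite: BrockerTomDieck1985, IV (3.2)] [cite: Rogawski1990, §8.2 p. 122] -/
theorem nc_closure_bool : ∀ (s : Fin 3 → Bool) (τ τ' : Equiv.Perm (Fin 3)),
    s (τ 0) ≠ s (τ 2) → s (τ' 0) ≠ s (τ' 2) →
    τ' = τ ∨ τ' = τ * swap (0 : Fin 3) 2 ∨
      (s (τ 0) = s (τ 1) ∧ (τ' = τ * swap (0 : Fin 3) 1 ∨ τ' = τ * swap (0 : Fin 3) 1 * swap (0 : Fin 3) 2)) ∨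
      (s (τ 2) = s (τ 1) ∧ (τ' = τ * swap (0 : Fin 3) 2 * swap (0 : Fin 3) 1 ∨ τ' = τ * swap (0 : Fin 3) 2 * swap (0 : Fin 3) 1 * swap (0 : Fin 3) 2)) := by
  decide

/-- Sign bookkeeping: for non-zero reals, `a·b < 0` iff exactly one of `a, b` is positive. [cite: Rogawski1990, §8.2 p. 119] -/
theorem mul_neg_iff_not_pos_iff_pos {a b : ℝ} (ha : a ≠ 0) (hb : b ≠ 0) : a * b < 0 ↔ ¬ ((0 < a) ↔ (0 < b)) := by
  rcases lt_or_gt_of_ne ha with ha | ha <;> rcases lt_or_gt_of_ne hb with hb | hb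
  · exact ⟨fun h => absurd (mul_pos_of_neg_of_neg ha hb) (not_lt.2 h.le),
      fun h => (h ⟨fun h' => absurd h' (not_lt.2 ha.le), fun h' => absurd h' (not_lt.2 hb.le)⟩).elim⟩
  · exact ⟨fun _ h => absurd (h.2 hb) (not_lt.2 ha.le), fun _ => mul_neg_of_neg_of_pos ha hb⟩
  · exact ⟨fun _ h => absurd (h.1 ha) (not_lt.2 hb.le), fun _ => mul_neg_of_pos_of_neg ha hb⟩
  · exact ⟨fun h => absurd (mul_pos ha hb) (not_lt.2 h.le), fun h => (h ⟨fun _ => hb, fun _ => ha⟩).elim⟩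

/-- Sign bookkeeping: for non-zero reals, `0 < a·b` iff (`a > 0` iff `b > 0`). [cite: Rogawski1990, §8.2 p. 119] -/
theorem mul_pos_iff_pos_iff_pos {a b : ℝ} (ha : a ≠ 0) (hb : b ≠ 0) : 0 < a * b ↔ ((0 < a) ↔ (0 < b)) := by
  rcases lt_or_gt_of_ne ha with ha | ha <;> rcases lt_or_gt_of_ne hb with hb | hb
  · exact ⟨fun _ => ⟨fun h' => absurd h' (not_lt.2 ha.le), fun h' => absurd h' (not_lt.2 hb.le)⟩, fun _ => mul_pos_of_neg_of_neg ha hb⟩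
  · exact ⟨fun h => absurd (mul_neg_of_neg_of_pos ha hb) (not_lt.2 h.le), fun h => absurd (h.2 hb) (not_lt.2 ha.le)⟩
  · exact ⟨fun h => absurd (mul_neg_of_pos_of_neg ha hb) (not_lt.2 h.le), fun h => absurd (h.1 ha) (not_lt.2 hb.le)⟩
  · exact ⟨fun _ => ⟨fun _ => hb, fun _ => ha⟩, fun _ => mul_pos ha hb⟩

/-- **(D2-coef) A LINK-INVARIANT FAMILY IS CONSTANT ON THE NONCOMPACT RELABELLINGS.**  Let `x : Fin 3 → ℝ` be non-vanishing (the real parts `re σ_w(α_i)`), call `τ` noncompact when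
`x(τ0)·x(τ2) < 0`, and let `c : Perm (Fin 3) → M` satisfy the two primitive links: `c (τ·(0 2)) = c τ` for noncompact `τ` (★ (b1) p842004) and `c (τ·(0 1)) = c τ` for noncompact
`τ` with `x(τ0)·x(τ1) > 0` (★ (b2′) p842051 at the rescaling `D`).  THEN `c τ = c τ′` for all noncompact `τ, τ′` — per place, the four noncompact wall constants are ONE `C_v`.
[cite: Rogawski1990, §8.2 pp. 122–124] [cite: BrockerTomDieck1985, IV (3.2)] -/
theorem const_eq_of_wallLinks {M : Type*} (x : Fin 3 → ℝ) (hx : ∀ i, x i ≠ 0) (c : Equiv.Perm (Fin 3) → M)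
    (h02 : ∀ τ : Equiv.Perm (Fin 3), x (τ 0) * x (τ 2) < 0 → c (τ * swap (0 : Fin 3) 2) = c τ)
    (h01 : ∀ τ : Equiv.Perm (Fin 3), x (τ 0) * x (τ 2) < 0 → 0 < x (τ 0) * x (τ 1) → c (τ * swap (0 : Fin 3) 1) = c τ) :
    ∀ τ τ' : Equiv.Perm (Fin 3), x (τ 0) * x (τ 2) < 0 → x (τ' 0) * x (τ' 2) < 0 → c τ = c τ' := by
  intro τ τ' hτ hτ'
  -- Boolean signs
  set s : Fin 3 → Bool := fun i => decide (0 < x i) with hs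
  have hN : ∀ a b : Fin 3, x a * x b < 0 ↔ s a ≠ s b := fun a b => by
    rw [mul_neg_iff_not_pos_iff_pos (hx a) (hx b), hs]
    simp only [ne_eq, decide_eq_decide]
  have hP : ∀ a b : Fin 3, 0 < x a * x b ↔ s a = s b := fun a b => by
    rw [mul_pos_iff_pos_iff_pos (hx a) (hx b), hs]
    simp only [decide_eq_decide]
  -- values of the moved relabellings
  have e02_0 : ∀ ρ : Equiv.Perm (Fin 3), (ρ * swap (0 : Fin 3) 2) 0 = ρ 2 := fun ρ => by simp [Equiv.Perm.mul_apply, swap_apply_left]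
  have e02_1 : ∀ ρ : Equiv.Perm (Fin 3), (ρ * swap (0 : Fin 3) 2) 1 = ρ 1 := fun ρ => by
    simp [Equiv.Perm.mul_apply, swap_apply_of_ne_of_ne]
  have e02_2 : ∀ ρ : Equiv.Perm (Fin 3), (ρ * swap (0 : Fin 3) 2) 2 = ρ 0 := fun ρ => by simp [Equiv.Perm.mul_apply, swap_apply_right]
  have e01_0 : ∀ ρ : Equiv.Perm (Fin 3), (ρ * swap (0 : Fin 3) 1) 0 = ρ 1 := fun ρ => by simp [Equiv.Perm.mul_apply, swap_apply_left]
  have e01_2 : ∀ ρ : Equiv.Perm (Fin 3), (ρ * swap (0 : Fin 3) 1) 2 = ρ 2 := fun ρ => by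
    simp [Equiv.Perm.mul_apply, swap_apply_of_ne_of_ne]
  -- derived links as equalities `c (moved) = c ρ` under sign conditions phrased with `s`
  have L02 : ∀ ρ : Equiv.Perm (Fin 3), s (ρ 0) ≠ s (ρ 2) → c (ρ * swap (0 : Fin 3) 2) = c ρ := fun ρ h => h02 ρ ((hN _ _).2 h)
  have L01 : ∀ ρ : Equiv.Perm (Fin 3), s (ρ 0) ≠ s (ρ 2) → s (ρ 0) = s (ρ 1) → c (ρ * swap (0 : Fin 3) 1) = c ρ :=
    fun ρ h h' => h01 ρ ((hN _ _).2 h) ((hP _ _).2 h')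
  have nτ : s (τ 0) ≠ s (τ 2) := (hN _ _).1 hτ
  have nτ' : s (τ' 0) ≠ s (τ' 2) := (hN _ _).1 hτ'
  rcases nc_closure_bool s τ τ' nτ nτ' with h | h | ⟨hs01, h | h⟩ | ⟨hs21, h | h⟩
  · rw [h]
  · rw [h, L02 τ nτ]
  · rw [h, L01 τ nτ hs01]
  · -- τ' = τ (01) (02): the middle point τ(01) is noncompact: signs at its slots 0,2 are s(τ1) ≠ s(τ2)
    have n1 : s ((τ * swap (0 : Fin 3) 1) 0) ≠ s ((τ * swap (0 : Fin 3) 1) 2) := by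
      rw [e01_0, e01_2]; exact fun h' => nτ (hs01.trans h')
    rw [h, L02 _ n1, L01 τ nτ hs01]
  · -- τ' = τ (02) (01): τ(02) is noncompact with equal signs at slots 0,1
    have n2 : s ((τ * swap (0 : Fin 3) 2) 0) ≠ s ((τ * swap (0 : Fin 3) 2) 2) := by
      rw [e02_0, e02_2]; exact fun h' => nτ h'.symm
    have p2 : s ((τ * swap (0 : Fin 3) 2) 0) = s ((τ * swap (0 : Fin 3) 2) 1) := by rw [e02_0, e02_1]; exact hs21
    rw [h, L01 _ n2 p2, L02 τ nτ]
  · -- τ' = τ (02) (01) (02)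
    have n2 : s ((τ * swap (0 : Fin 3) 2) 0) ≠ s ((τ * swap (0 : Fin 3) 2) 2) := by
      rw [e02_0, e02_2]; exact fun h' => nτ h'.symm
    have p2 : s ((τ * swap (0 : Fin 3) 2) 0) = s ((τ * swap (0 : Fin 3) 2) 1) := by rw [e02_0, e02_1]; exact hs21
    have n3 : s ((τ * swap (0 : Fin 3) 2 * swap (0 : Fin 3) 1) 0) ≠ s ((τ * swap (0 : Fin 3) 2 * swap (0 : Fin 3) 1) 2) := by
      rw [e01_0, e01_2, e02_1, e02_2]; exact fun h' => nτ (h'.symm.trans hs21.symm ▸ rfl : s (τ 0) = s (τ 2))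
    rw [h, L02 _ n3, L01 _ n2 p2, L02 τ nτ]

end Combinatorics

/-! ## §2 ★ (b1) with a free target reference point -/

section Swap02

variable (L : Type) [Field L] [NumberField L] [IsCMField L] (β : Fin 3 → L) (w : {w : InfinitePlace L // IsComplex w})

/-- At a wall point the `(0 2)`-relabelled reference coincides with the reference: `z₁ ∘ (0 2)⁻¹ = z₁` when `z₁ 0 = z₁ 2` (propositional, not syntactic — whence the
free-reference variant below). [cite: Rogawski1990, §8.2 p. 122] -/
theorem comp_swap02_symm_eq_self_of_wall (z₁ : Fin 3 → Circle) (h02 : z₁ 0 = z₁ 2) :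
    (fun i => z₁ ((Equiv.swap (0 : Fin 3) 2).symm i)) = z₁ := by
  funext i
  rw [Equiv.symm_swap]
  fin_cases i
  · simp [swap_apply_left, h02]
  · have h : (Equiv.swap (0 : Fin 3) 2) 1 = 1 := swap_apply_of_ne_of_ne (by decide) (by decide)
    simp [h]
  · simp [swap_apply_right, h02]

/-- **★ (b1) WITH A FREE TARGET REFERENCE**: as ★ `archLimitFormulaNoncompactWall_const_eq_of_transport_swap02`, the target reference point being any `z₁t` with
`hz : z₁∘(0 2)⁻¹ = z₁t` (e.g. `z₁t = z₁` by `comp_swap02_symm_eq_self_of_wall`) and the centraliser transport proof supplied by the caller as `hE : e_σ (diag z₁) = diag z₁t`.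
[cite: Rogawski1990, §8.2 pp. 119, 122–124] [cite: Varadarajan1989, §6.4 Thm 22] -/
theorem archLimitFormulaNoncompactWall_const_eq_of_transport_swap02_of_eq
    [LocallyCompactSpace (archLocal L 3 (Matrix.diagonal (β ∘ (Equiv.swap (0 : Fin 3) 2))) w)] [SecondCountableTopology (archLocal L 3 (Matrix.diagonal (β ∘ (Equiv.swap (0 : Fin 3) 2))) w)] [MeasurableSpace (archLocal L 3 (Matrix.diagonal (β ∘ (Equiv.swap (0 : Fin 3) 2))) w)] [BorelSpace (archLocal L 3 (Matrix.diagonal (β ∘ (Equiv.swap (0 : Fin 3) 2))) w)]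
    [LocallyCompactSpace (archLocal L 3 (Matrix.diagonal β) w)] [SecondCountableTopology (archLocal L 3 (Matrix.diagonal β) w)] [MeasurableSpace (archLocal L 3 (Matrix.diagonal β) w)] [BorelSpace (archLocal L 3 (Matrix.diagonal β) w)]
    (hβ : ∀ i, β i ≠ 0) (hreal : ∀ i, (w.1.embedding (β i)).im = 0)
    (ν' : Measure (archLocal L 3 (Matrix.diagonal (β ∘ (Equiv.swap (0 : Fin 3) 2))) w)) [ν'.IsHaarMeasure] [ν'.IsMulRightInvariant]
    (ν : Measure (archLocal L 3 (Matrix.diagonal β) w)) [ν.IsHaarMeasure] [ν.IsMulRightInvariant]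
    (hν : ν = ν'.map (ContinuousMulEquiv.restrictSubgroup (GLn.conjEquiv (Matrix.GeneralLinearGroup.mkOfDetNeZero _ (det_monomial_one_ne_zero 3 (Equiv.swap (0 : Fin 3) 2))))
        (archLocal L 3 (Matrix.diagonal (β ∘ (Equiv.swap (0 : Fin 3) 2))) w) (archLocal L 3 (Matrix.diagonal β) w) (mem_archLocal_comp_perm_iff_conj_mem L 3 β w (Equiv.swap (0 : Fin 3) 2))))
    (z₁ : Fin 3 → Circle) (h02 : z₁ 0 = z₁ 2) (h01 : z₁ 0 ≠ z₁ 1)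
    (z₁t : Fin 3 → Circle) (hz : (fun i => z₁ ((Equiv.swap (0 : Fin 3) 2).symm i)) = z₁t) (h02t : z₁t 0 = z₁t 2) (h01t : z₁t 0 ≠ z₁t 1)
    (hE : ((ContinuousMulEquiv.restrictSubgroup (GLn.conjEquiv (Matrix.GeneralLinearGroup.mkOfDetNeZero _ (det_monomial_one_ne_zero 3 (Equiv.swap (0 : Fin 3) 2))))
        (archLocal L 3 (Matrix.diagonal (β ∘ (Equiv.swap (0 : Fin 3) 2))) w) (archLocal L 3 (Matrix.diagonal β) w) (mem_archLocal_comp_perm_iff_conj_mem L 3 β w (Equiv.swap (0 : Fin 3) 2)))).toMulEquiv (⟨circleDiagonal 3 z₁, circleDiagonal_mem_archLocal_diagonal L 3 (β ∘ (Equiv.swap (0 : Fin 3) 2)) w _⟩ : archLocal L 3 (Matrix.diagonal (β ∘ (Equiv.swap (0 : Fin 3) 2))) w) = (⟨circleDiagonal 3 z₁t, circleDiagonal_mem_archLocal_diagonal L 3 β w _⟩ : archLocal L 3 (Matrix.diagonal β) w))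
    (νH' : Measure (Subgroup.centralizer ({(⟨circleDiagonal 3 z₁, circleDiagonal_mem_archLocal_diagonal L 3 (β ∘ (Equiv.swap (0 : Fin 3) 2)) w _⟩ : archLocal L 3 (Matrix.diagonal (β ∘ (Equiv.swap (0 : Fin 3) 2))) w)} : Set (archLocal L 3 (Matrix.diagonal (β ∘ (Equiv.swap (0 : Fin 3) 2))) w)))) [νH'.IsHaarMeasure] [νH'.IsInvInvariant]
    (νH : Measure (Subgroup.centralizer ({(⟨circleDiagonal 3 z₁t, circleDiagonal_mem_archLocal_diagonal L 3 β w _⟩ : archLocal L 3 (Matrix.diagonal β) w)} : Set (archLocal L 3 (Matrix.diagonal β) w)))) [νH.IsHaarMeasure] [νH.IsInvInvariant]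
    (hνH : νH = νH'.map (subgroupCongrHomeomorph (ContinuousMulEquiv.restrictSubgroup (GLn.conjEquiv (Matrix.GeneralLinearGroup.mkOfDetNeZero _ (det_monomial_one_ne_zero 3 (Equiv.swap (0 : Fin 3) 2))))
        (archLocal L 3 (Matrix.diagonal (β ∘ (Equiv.swap (0 : Fin 3) 2))) w) (archLocal L 3 (Matrix.diagonal β) w) (mem_archLocal_comp_perm_iff_conj_mem L 3 β w (Equiv.swap (0 : Fin 3) 2))).toMulEquiv
      (Subgroup.centralizer ({(⟨circleDiagonal 3 z₁, circleDiagonal_mem_archLocal_diagonal L 3 (β ∘ (Equiv.swap (0 : Fin 3) 2)) w _⟩ : archLocal L 3 (Matrix.diagonal (β ∘ (Equiv.swap (0 : Fin 3) 2))) w)} : Set (archLocal L 3 (Matrix.diagonal (β ∘ (Equiv.swap (0 : Fin 3) 2))) w))) (Subgroup.centralizer ({(⟨circleDiagonal 3 z₁t, circleDiagonal_mem_archLocal_diagonal L 3 β w _⟩ : archLocal L 3 (Matrix.diagonal β) w)} : Set (archLocal L 3 (Matrix.diagonal β) w)))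
      (forall_apply_mem_centralizer_singleton_iff_of_eq (ContinuousMulEquiv.restrictSubgroup (GLn.conjEquiv (Matrix.GeneralLinearGroup.mkOfDetNeZero _ (det_monomial_one_ne_zero 3 (Equiv.swap (0 : Fin 3) 2))))
        (archLocal L 3 (Matrix.diagonal (β ∘ (Equiv.swap (0 : Fin 3) 2))) w) (archLocal L 3 (Matrix.diagonal β) w) (mem_archLocal_comp_perm_iff_conj_mem L 3 β w (Equiv.swap (0 : Fin 3) 2))).toMulEquiv hE)
      (ContinuousMulEquiv.restrictSubgroup (GLn.conjEquiv (Matrix.GeneralLinearGroup.mkOfDetNeZero _ (det_monomial_one_ne_zero 3 (Equiv.swap (0 : Fin 3) 2))))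
        (archLocal L 3 (Matrix.diagonal (β ∘ (Equiv.swap (0 : Fin 3) 2))) w) (archLocal L 3 (Matrix.diagonal β) w) (mem_archLocal_comp_perm_iff_conj_mem L 3 β w (Equiv.swap (0 : Fin 3) 2))).continuous (ContinuousMulEquiv.restrictSubgroup (GLn.conjEquiv (Matrix.GeneralLinearGroup.mkOfDetNeZero _ (det_monomial_one_ne_zero 3 (Equiv.swap (0 : Fin 3) 2))))
        (archLocal L 3 (Matrix.diagonal (β ∘ (Equiv.swap (0 : Fin 3) 2))) w) (archLocal L 3 (Matrix.diagonal β) w) (mem_archLocal_comp_perm_iff_conj_mem L 3 β w (Equiv.swap (0 : Fin 3) 2))).symm.continuous))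
    [MeasurableSpace (archLocal L 3 (Matrix.diagonal (β ∘ (Equiv.swap (0 : Fin 3) 2))) w ⧸ Subgroup.centralizer ({(⟨circleDiagonal 3 z₁, circleDiagonal_mem_archLocal_diagonal L 3 (β ∘ (Equiv.swap (0 : Fin 3) 2)) w _⟩ : archLocal L 3 (Matrix.diagonal (β ∘ (Equiv.swap (0 : Fin 3) 2))) w)} : Set (archLocal L 3 (Matrix.diagonal (β ∘ (Equiv.swap (0 : Fin 3) 2))) w)))] [BorelSpace (archLocal L 3 (Matrix.diagonal (β ∘ (Equiv.swap (0 : Fin 3) 2))) w ⧸ Subgroup.centralizer ({(⟨circleDiagonal 3 z₁, circleDiagonal_mem_archLocal_diagonal L 3 (β ∘ (Equiv.swap (0 : Fin 3) 2)) w _⟩ : archLocal L 3 (Matrix.diagonal (β ∘ (Equiv.swap (0 : Fin 3) 2))) w)} : Set (archLocal L 3 (Matrix.diagonal (β ∘ (Equiv.swap (0 : Fin 3) 2))) w)))]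
    [MeasurableSpace (archLocal L 3 (Matrix.diagonal β) w ⧸ Subgroup.centralizer ({(⟨circleDiagonal 3 z₁t, circleDiagonal_mem_archLocal_diagonal L 3 β w _⟩ : archLocal L 3 (Matrix.diagonal β) w)} : Set (archLocal L 3 (Matrix.diagonal β) w)))] [BorelSpace (archLocal L 3 (Matrix.diagonal β) w ⧸ Subgroup.centralizer ({(⟨circleDiagonal 3 z₁t, circleDiagonal_mem_archLocal_diagonal L 3 β w _⟩ : archLocal L 3 (Matrix.diagonal β) w)} : Set (archLocal L 3 (Matrix.diagonal β) w)))]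
    {c₁ c₂ : ℂ}
    (h₁ : ∀ (Θ : Matrix (Fin 3) (Fin 3) ℂ → ℂ), ContDiff ℝ (⊤ : ℕ∞) Θ →
        HasCompactSupport (fun k : archLocal L 3 (Matrix.diagonal β) w => Θ ((k : GL (Fin 3) ℂ) : Matrix (Fin 3) (Fin 3) ℂ)) →
        ∀ (z₀ : Fin 3 → Circle) (h02' : z₀ 0 = z₀ 2) (h01' : z₀ 0 ≠ z₀ 1),
          Tendsto (fun ψ : ℝ => deriv (fun ψ : ℝ => (2 * Real.sin ψ : ℂ) *
              ∫ g, Θ (((g * (⟨circleDiagonal 3 (fun i => z₀ i * Circle.exp (![(1 : ℝ), 0, -1] i * ψ)), circleDiagonal_mem_archLocal_diagonal L 3 β w _⟩ : archLocal L 3 (Matrix.diagonal β) w) * g⁻¹ : archLocal L 3 (Matrix.diagonal β) w) : GL (Fin 3) ℂ) : Matrix (Fin 3) (Fin 3) ℂ) ∂ν) ψ)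
            (𝓝[≠] 0)
            (𝓝 (c₁ * ∫ y, descConj (⟨circleDiagonal 3 z₀, circleDiagonal_mem_archLocal_diagonal L 3 β w _⟩ : archLocal L 3 (Matrix.diagonal β) w)
              (Subgroup.centralizer ({(⟨circleDiagonal 3 z₁t, circleDiagonal_mem_archLocal_diagonal L 3 β w _⟩ : archLocal L 3 (Matrix.diagonal β) w)} : Set (archLocal L 3 (Matrix.diagonal β) w)))
              (forall_mem_centralizer_circleDiagonal_comm_of_wall L β w h02t h01t h02' h01')
              (fun k : archLocal L 3 (Matrix.diagonal β) w => Θ ((k : GL (Fin 3) ℂ) : Matrix (Fin 3) (Fin 3) ℂ)) y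
              ∂(quotientMeasure _ νH (isClosed_coe_centralizer_singleton _) ν))))
    (h₂ : ∀ (Θ : Matrix (Fin 3) (Fin 3) ℂ → ℂ), ContDiff ℝ (⊤ : ℕ∞) Θ →
        HasCompactSupport (fun k : archLocal L 3 (Matrix.diagonal (β ∘ (Equiv.swap (0 : Fin 3) 2))) w => Θ ((k : GL (Fin 3) ℂ) : Matrix (Fin 3) (Fin 3) ℂ)) →
        ∀ (z₀ : Fin 3 → Circle) (h02' : z₀ 0 = z₀ 2) (h01' : z₀ 0 ≠ z₀ 1),
          Tendsto (fun ψ : ℝ => deriv (fun ψ : ℝ => (2 * Real.sin ψ : ℂ) *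
              ∫ g, Θ (((g * (⟨circleDiagonal 3 (fun i => z₀ i * Circle.exp (![(1 : ℝ), 0, -1] i * ψ)), circleDiagonal_mem_archLocal_diagonal L 3 (β ∘ (Equiv.swap (0 : Fin 3) 2)) w _⟩ : archLocal L 3 (Matrix.diagonal (β ∘ (Equiv.swap (0 : Fin 3) 2))) w) * g⁻¹ : archLocal L 3 (Matrix.diagonal (β ∘ (Equiv.swap (0 : Fin 3) 2))) w) : GL (Fin 3) ℂ) : Matrix (Fin 3) (Fin 3) ℂ) ∂ν') ψ)
            (𝓝[≠] 0)
            (𝓝 (c₂ * ∫ y, descConj (⟨circleDiagonal 3 z₀, circleDiagonal_mem_archLocal_diagonal L 3 (β ∘ (Equiv.swap (0 : Fin 3) 2)) w _⟩ : archLocal L 3 (Matrix.diagonal (β ∘ (Equiv.swap (0 : Fin 3) 2))) w)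
              (Subgroup.centralizer ({(⟨circleDiagonal 3 z₁, circleDiagonal_mem_archLocal_diagonal L 3 (β ∘ (Equiv.swap (0 : Fin 3) 2)) w _⟩ : archLocal L 3 (Matrix.diagonal (β ∘ (Equiv.swap (0 : Fin 3) 2))) w)} : Set (archLocal L 3 (Matrix.diagonal (β ∘ (Equiv.swap (0 : Fin 3) 2))) w)))
              (forall_mem_centralizer_circleDiagonal_comm_of_wall L (β ∘ (Equiv.swap (0 : Fin 3) 2)) w h02 h01 h02' h01')
              (fun k : archLocal L 3 (Matrix.diagonal (β ∘ (Equiv.swap (0 : Fin 3) 2))) w => Θ ((k : GL (Fin 3) ℂ) : Matrix (Fin 3) (Fin 3) ℂ)) y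
              ∂(quotientMeasure _ νH' (isClosed_coe_centralizer_singleton _) ν')))) :
    c₁ = c₂ := by
  subst hz
  exact archLimitFormulaNoncompactWall_const_eq_of_transport_swap02 L β w hβ hreal ν' ν hν z₁ h02 h01 h02t h01t νH' νH hνH h₁ h₂

end Swap02

end Literature.NumberTheory.Rogawski1990

end
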